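import Summits.AtomisticToContinuum.HydrodynamicLimit.Theses.BoxDissipativeWeakStrong
import Literature.Analysis.FluidPDE.HardSphereFlowJointMeasurable
import Literature.MathematicalPhysics.KineticTheory.HardSphereEulerProofs
import Literature.Analysis.FunctionSpaces.TorusCalculusProofs
import Literature.Analysis.FunctionSpaces.TorusSpaceTime
import Summits.AtomisticToContinuum.HydrodynamicLimit.Theorems.BoxDissipativeWeakStrongLocalGibbsFineScaleKernels
import HarnessLib

/-!
# A.e.-measurability of the kinetic deviation functional under the local Gibbs law
— stub `stub_kinDevAEMeasurable` (B5) of line `birth`, crux `FluxClosure`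
(route `BoxDissipativeWeakStrong`, item stmt-AtomisticToContinuum-9902)

For `N + 1` hard spheres of reduced diameter `σ` on `𝕋³` with flow `Φ N`, a kinetic window `ℓ N`
and the cube kernel `K_ℓ(x, y) = ℓ⁻³ 𝟙[∀ i, ‖yᵢ - xᵢ‖ < ℓ/2]`, the box fields of the evolved
configuration `Φ_t z` are `ρ̂ = empiricalDensityField (Φ_t z) (K_ℓ x ·)`, `m̂`, `Ê` and the box
kinetic stress `S_ij = ∫ K_ℓ(x, q) vᵢ vⱼ dμ_{Φ_t z}`. The **kinetic deviation functional**
`KinDev_N(z) = ∫_{t ∈ (0,τ]} ∫_x Σ_ij (S_ij - m̂ᵢ m̂ⱼ / ρ̂ - δ_ij ρ̂ θ̂) ∂ⱼ wᵢ(t, x) dx dt`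
(`θ̂ = ⅔(Ê/ρ̂ - ‖m̂‖²/(2ρ̂²))`, `w` a test field smooth on the slab `[0,T) × 𝕋³`, `τ ∈ [0,T)`) is
a.e.-measurable for the local Gibbs law `P_N = localGibbsLaw σ a₀ u₀ θ₀ N (Φ N)`. This is the
measurability input of the `L¹(P_N)` triangle inequality in the glue of the crux skeleton.

Outline. (1) The box fields are finite averages over the particles (`empirical*Field_eq_sum`,
`integral_empiricalMeasure`) of a kernel jointly measurable in `(x, q)`
(`LGFS.measurable_boxK_uncurry`), hence jointly measurable in (configuration, `x`)
(`measurable_kinDevIntegrand`). (2) The test-field factor `(t, x) ↦ ∂ⱼ wᵢ(t, x)` is only smooth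
on the slab; composing the time variable with a continuous clamp `ρ` into `[0,T)` that is the
identity on `(0, τ]` gives a globally measurable modification (continuity of the space–time lift
of `∂ⱼ wᵢ`, `Torus.IsSmoothSpaceTimeOn.partialDeriv`, read on `ℝ × 𝕋³` through the measurable
section `Torus.repr`), which does not change the `t`-integral over `(0, τ]`. (3) Fubini
measurability (`StronglyMeasurable.integral_prod_right'`) in `x`, then — after composing with
the flow, jointly measurable on `good × ℝ` (`HardSphereFlow.measurable_flow_prod_torus`) — in
`t`, gives measurability on the good subtype; the local Gibbs law is a density against the
Liouville measure (`particleLaw_eq`), so it is carried by the good set and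
`HardSphereFlow.aemeasurable_of_measurable_comp_subtype` concludes.

References: H. Spohn, *Large Scale Dynamics of Interacting Particles* (1991), Part I §3.2–3.3;
C. Cercignani, R. Illner, M. Pulvirenti, *The Mathematical Theory of Dilute Gases* (1994), §4.2.
-/

noncomputable section

namespace Summit.AtomisticToContinuum.HydrodynamicLimit.Theorems

namespace FluxClosureB5

open scoped BigOperators Topology Classical MeasureTheory ProbabilityTheory InnerProductSpace ENNReal
open Filter Set Function MeasureTheory
open Literature.MathematicalPhysics.KineticTheory Literature.Analysis.FluidPDE Literature.Analysis.FunctionSpaces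

/-! ## The test-field factor: a measurable modification off the slab -/

/-- A field on `ℝ × 𝕋³` whose space–time lift is continuous on `S × ℝ³`, with the time variable
precomposed with a continuous map `ρ` into `S`, is jointly measurable on `ℝ × 𝕋³` (read the lift
along the measurable section `Torus.repr`). -/
theorem measurable_comp_clamp_of_continuousOn_stLift {S : Set ℝ} {u : ℝ → T3 → ℝ}
    (hu : ContinuousOn (Torus.stLift u) (S ×ˢ univ)) {ρ : ℝ → ℝ} (hρ : Continuous ρ)
    (hρS : ∀ t, ρ t ∈ S) : Measurable fun p : ℝ × T3 => u (ρ p.1) p.2 := by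
  have hg : Continuous fun q : ℝ × V3 => Torus.stLift u (ρ q.1, q.2) :=
    hu.comp_continuous ((hρ.comp continuous_fst).prodMk continuous_snd) fun q =>
      mk_mem_prod (hρS q.1) (mem_univ _)
  have heq : (fun p : ℝ × T3 => u (ρ p.1) p.2) =
      (fun q : ℝ × V3 => Torus.stLift u (ρ q.1, q.2)) ∘ fun p : ℝ × T3 => (p.1, Torus.repr p.2) := by
    funext p
    simp only [comp_apply, Torus.stLift_apply, Torus.proj_repr]
  rw [heq]
  exact hg.measurable.comp (measurable_fst.prodMk (Torus.measurable_repr.comp measurable_snd))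

/-- For a vector field `w` smooth on the slab `S × 𝕋³` (`S` of unique differentiability) and a
continuous clamp `ρ : ℝ → S`, the factor `(t, x) ↦ ∂ⱼ wᵢ(ρ t, x)` is jointly measurable. -/
theorem measurable_partialDeriv_comp_clamp {S : Set ℝ} {w : ℝ → T3 → V3}
    (hw : Torus.IsSmoothSpaceTimeOn S w) (hS : UniqueDiffOn ℝ S) {ρ : ℝ → ℝ} (hρ : Continuous ρ)
    (hρS : ∀ t, ρ t ∈ S) (i j : Fin 3) :
    Measurable fun p : ℝ × T3 => Torus.partialDeriv j (fun y => w (ρ p.1) y i) p.2 := by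
  have hD : Torus.IsSmoothSpaceTimeOn S fun t => Torus.partialDeriv j (fun y => w t y i) :=
    (hw.apply i).partialDeriv hS j
  exact measurable_comp_clamp_of_continuousOn_stLift hD.continuousOn_stLift hρ hρS

/-- A continuous clamp of the time axis into `[0, T)` which is the identity on `(0, τ]`,
for `τ ∈ [0, T)`: `ρ t = max 0 (min t τ')` with `τ' = (τ + T)/2`. -/
theorem exists_clamp {T τ : ℝ} (hτ : τ ∈ Ico 0 T) :
    ∃ ρ : ℝ → ℝ, Continuous ρ ∧ (∀ t, ρ t ∈ Ico 0 T) ∧ ∀ t ∈ Ioc 0 τ, ρ t = t := by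
  refine ⟨fun t => max 0 (min t ((τ + T) / 2)), continuous_const.max (continuous_id.min continuous_const),
    fun t => ⟨le_max_left _ _, ?_⟩, fun t ht => ?_⟩
  · have h1 : (τ + T) / 2 < T := by linarith [hτ.2]
    exact max_lt (hτ.1.trans_lt hτ.2) ((min_le_right _ _).trans_lt h1)
  · have h1 : t ≤ (τ + T) / 2 := by linarith [ht.2, hτ.2]
    show max 0 (min t ((τ + T) / 2)) = t
    rw [min_eq_left h1, max_eq_right ht.1.le]

/-! ## The box fields are jointly measurable in (configuration, point) -/

variable {n : ℕ} {K : T3 → T3 → ℝ}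

/-- The kernel evaluated at a particle position is jointly measurable. -/
theorem measurable_kernel_pos (hK : Measurable fun p : T3 × T3 => K p.1 p.2) (a : Fin n) :
    Measurable fun p : Config n (Fin 3) T3 × T3 => K p.2 (p.1 a).1 :=
  hK.comp (measurable_snd.prodMk ((measurable_pi_apply a).comp measurable_fst).fst)

/-- A particle velocity is a measurable function of (configuration, point). -/
theorem measurable_vel (a : Fin n) :
    Measurable fun p : Config n (Fin 3) T3 × T3 => (p.1 a).2 :=
  ((measurable_pi_apply a).comp measurable_fst).snd

/-- A particle velocity component is a measurable function of (configuration, point). -/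
theorem measurable_vel_apply (a : Fin n) (i : Fin 3) :
    Measurable fun p : Config n (Fin 3) T3 × T3 => (p.1 a).2 i := by
  have h := measurable_vel (n := n) a
  fun_prop

/-- The box density `ρ̂(z, x) = empiricalDensityField z (K x ·)` is jointly measurable. -/
theorem measurable_density (hK : Measurable fun p : T3 × T3 => K p.1 p.2) :
    Measurable fun p : Config n (Fin 3) T3 × T3 => empiricalDensityField p.1 (K p.2) := by
  simp_rw [empiricalDensityField_eq_sum]
  exact (Finset.measurable_sum _ fun a _ => measurable_kernel_pos hK a).const_mul _

/-- The box momentum `m̂(z, x) = empiricalMomentumField z (K x ·)` is jointly measurable. -/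
theorem measurable_momentum (hK : Measurable fun p : T3 × T3 => K p.1 p.2) :
    Measurable fun p : Config n (Fin 3) T3 × T3 => empiricalMomentumField p.1 (K p.2) := by
  simp_rw [empiricalMomentumField_eq_sum]
  exact (Finset.measurable_sum _ fun a _ =>
    (measurable_kernel_pos hK a).smul (measurable_vel a)).const_smul ((n : ℝ)⁻¹)

/-- The components of the box momentum are jointly measurable. -/
theorem measurable_momentum_apply (hK : Measurable fun p : T3 × T3 => K p.1 p.2) (i : Fin 3) :
    Measurable fun p : Config n (Fin 3) T3 × T3 => empiricalMomentumField p.1 (K p.2) i := by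
  have h := measurable_momentum (n := n) hK
  fun_prop

/-- The box energy `Ê(z, x) = empiricalEnergyField z (K x ·)` is jointly measurable. -/
theorem measurable_energy (hK : Measurable fun p : T3 × T3 => K p.1 p.2) :
    Measurable fun p : Config n (Fin 3) T3 × T3 => empiricalEnergyField p.1 (K p.2) := by
  simp_rw [empiricalEnergyField_eq_sum]
  exact (Finset.measurable_sum _ fun a _ =>
    (measurable_kernel_pos hK a).mul (((measurable_vel a).norm.pow_const 2).div_const 2)).const_mul _

/-- The box kinetic stress `S_ij(z, x) = ∫ K(x, q) vᵢ vⱼ dμ_z` is jointly measurable. -/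
theorem measurable_stress (hK : Measurable fun p : T3 × T3 => K p.1 p.2) (i j : Fin 3) :
    Measurable fun p : Config n (Fin 3) T3 × T3 =>
      ∫ y, K p.2 y.1 * (y.2 i * y.2 j) ∂(empiricalMeasure p.1) := by
  simp_rw [integral_empiricalMeasure]
  exact (Finset.measurable_sum _ fun a _ =>
    (measurable_kernel_pos hK a).mul ((measurable_vel_apply a i).mul (measurable_vel_apply a j))).const_mul _

/-- **The kinetic deviation integrand is jointly measurable** in (configuration, point):
`(S - m̂ ⊗ m̂ / ρ̂ - δ ρ̂ θ̂)_ij` with `θ̂ = ⅔(Ê/ρ̂ - ‖m̂‖²/(2ρ̂²))`. -/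
theorem measurable_kinDevIntegrand (hK : Measurable fun p : T3 × T3 => K p.1 p.2) (i j : Fin 3) :
    Measurable fun p : Config n (Fin 3) T3 × T3 =>
      (∫ y, K p.2 y.1 * (y.2 i * y.2 j) ∂(empiricalMeasure p.1)) -
        empiricalMomentumField p.1 (K p.2) i * empiricalMomentumField p.1 (K p.2) j /
          empiricalDensityField p.1 (K p.2) -
        (if i = j then empiricalDensityField p.1 (K p.2) *
          (2 / 3 * (empiricalEnergyField p.1 (K p.2) / empiricalDensityField p.1 (K p.2) -
            ‖empiricalMomentumField p.1 (K p.2)‖ ^ 2 / (2 * empiricalDensityField p.1 (K p.2) ^ 2)))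
        else 0) := by
  have hD := measurable_density (n := n) hK
  have hM := measurable_momentum (n := n) hK
  have hMi := measurable_momentum_apply (n := n) hK
  have hE := measurable_energy (n := n) hK
  refine ((measurable_stress hK i j).sub (((hMi i).mul (hMi j)).div hD)).sub ?_
  rcases eq_or_ne i j with h | h
  · simp_rw [if_pos h]
    exact hD.mul (((hE.div hD).sub ((hM.norm.pow_const 2).div ((hD.pow_const 2).const_mul 2))).const_mul _)
  · simp_rw [if_neg h]
    exact measurable_const

/-! ## Fubini measurability along the flow -/

/-- **A.e.-measurability of flux pairings along the flow.** For a hard-sphere flow `Ψ` on `𝕋³`,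
a family `S (z, x) i j` jointly measurable in `(z, x)`, a test field `w` smooth on `[0,T) × 𝕋³`,
`τ ∈ [0,T)` and a law `μ` carried by the good set of `Ψ`, the functional
`z ↦ ∫_{(0,τ]} ∫_x Σ_ij S(Ψ_t z, x)_ij ∂ⱼ wᵢ(t, x) dx dt` is `μ`-a.e. measurable. -/
theorem aemeasurable_fluxPairing {ε : ℝ} (Ψ : HardSphereFlow (Torus.geometry (Fin 3)) ε n)
    {S : Config n (Fin 3) T3 × T3 → Fin 3 → Fin 3 → ℝ}
    (hS : ∀ i j, Measurable fun p : Config n (Fin 3) T3 × T3 => S p i j)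
    {T τ : ℝ} (hτ : τ ∈ Ico 0 T) {w : ℝ → T3 → V3} (hw : Torus.IsSmoothSpaceTimeOn (Ico 0 T) w)
    {μ : Measure (Config n (Fin 3) T3)} (hμ : μ Ψ.goodᶜ = 0) :
    AEMeasurable (fun z : Config n (Fin 3) T3 => ∫ t in Ioc 0 τ, ∫ x, ∑ i, ∑ j,
      S (Ψ.flow t z, x) i j * Torus.partialDeriv j (fun y => w t y i) x) μ := by
  obtain ⟨ρ, hρ, hρS, hρeq⟩ := exists_clamp hτ
  -- the clamped integrand is jointly measurable in `((t, z'), x)`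
  have hF : Measurable fun q : (ℝ × Config n (Fin 3) T3) × T3 => ∑ i, ∑ j,
      S (q.1.2, q.2) i j * Torus.partialDeriv j (fun y => w (ρ q.1.1) y i) q.2 := by
    refine Finset.measurable_sum _ fun i _ => Finset.measurable_sum _ fun j _ => ?_
    exact ((hS i j).comp (measurable_fst.snd.prodMk measurable_snd)).mul
      ((measurable_partialDeriv_comp_clamp hw (uniqueDiffOn_Ico 0 T) hρ hρS i j).comp
        (measurable_fst.fst.prodMk measurable_snd))
  -- integrate out `x`
  have hH : StronglyMeasurable fun p : ℝ × Config n (Fin 3) T3 => ∫ x, ∑ i, ∑ j,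
      S (p.2, x) i j * Torus.partialDeriv j (fun y => w (ρ p.1) y i) x :=
    hF.stronglyMeasurable.integral_prod_right'
  -- compose with the flow, jointly measurable on `good × ℝ`, and integrate out `t`
  have hG : StronglyMeasurable fun p : Ψ.good × ℝ => ∫ x, ∑ i, ∑ j,
      S (Ψ.flow p.2 (p.1 : Config n (Fin 3) T3), x) i j *
        Torus.partialDeriv j (fun y => w (ρ p.2) y i) x :=
    hH.comp_measurable (measurable_snd.prodMk Ψ.measurable_flow_prod_torus)
  have hI : StronglyMeasurable fun z : Ψ.good => ∫ t in Ioc 0 τ, ∫ x, ∑ i, ∑ j,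
      S (Ψ.flow t (z : Config n (Fin 3) T3), x) i j *
        Torus.partialDeriv j (fun y => w (ρ t) y i) x :=
    hG.integral_prod_right'
  -- unclamp on `(0, τ]` and conclude
  refine Ψ.aemeasurable_of_measurable_comp_subtype ?_ hμ
  have heq : (fun z : Ψ.good => ∫ t in Ioc 0 τ, ∫ x, ∑ i, ∑ j,
      S (Ψ.flow t (z : Config n (Fin 3) T3), x) i j * Torus.partialDeriv j (fun y => w t y i) x) =
      fun z : Ψ.good => ∫ t in Ioc 0 τ, ∫ x, ∑ i, ∑ j,
        S (Ψ.flow t (z : Config n (Fin 3) T3), x) i j *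
          Torus.partialDeriv j (fun y => w (ρ t) y i) x := by
    funext z
    refine setIntegral_congr_fun measurableSet_Ioc fun t ht => ?_
    simp only [hρeq t ht]
  rw [heq]
  exact hI.measurable

/-! ## The stub -/

/-- **Stub B5 of line `birth` (crux `FluxClosure`)**: the kinetic deviation functional
`KinDev_N(z) = ∫_{(0,τ]} ∫ Σ_ij (S_kin - m̂⊗m̂/ρ̂ - δ ρ̂θ̂)_ij ∂ⱼ wᵢ dx dt` of the box fields along
the hard-sphere flow is a.e.-measurable under the local Gibbs law, for every `N`. -/
theorem stub_kinDevAEMeasurable : ∀ (σ T : ℝ) (a₀ θ₀ : T3 → ℝ) (u₀ : T3 → V3) (Φ : (N : ℕ) → HardSphereFlow (Torus.geometry (Fin 3)) (hsDiameter σ N) (N + 1)) (ℓ : ℕ → ℝ), let K := fun (l : ℝ) (x y : T3) => indicator {y' : T3 | ∀ i, ‖y' i - x i‖ < l / 2} (fun _ => (l ^ 3)⁻¹) y; let Dn := fun N t z x => empiricalDensityField ((Φ N).flow t z) (K (ℓ N) x); let Mm := fun N t z x => empiricalMomentumField ((Φ N).flow t z) (K (ℓ N) x); let En := fun N t z x =>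 empiricalEnergyField ((Φ N).flow t z) (K (ℓ N) x); let Sk := fun N t z x (i j : Fin 3) => ∫ y, K (ℓ N) x y.1 * (y.2 i * y.2 j) ∂(empiricalMeasure ((Φ N).flow t z)); let Th := fun (r : ℝ) (m : V3) (E : ℝ) => 2 / 3 * (E / r - ‖m‖ ^ 2 / (2 * r ^ 2)); ∀ τ ∈ Ico 0 T, ∀ w : ℝ → T3 → V3, Torus.IsSmoothSpaceTimeOn (Ico 0 T) w → ∀ N : ℕ, AEMeasurable (fun z : Config (N + 1) (Fin 3) T3 => ∫ t in Ioc 0 τ, ∫ x, ∑ i, ∑ j, (Sk N t z x i j - Mm N t z x i * Mm N t z x j / Dn N t z x - (if i = j then Dn N t z x * Th (Dn N t z x) (Mm N t z x) (En N t z x) else 0)) * Torus.partialDeriv j (fun y => w t y i) x) (localGibbsLaw σ a₀ u₀ θ₀ N (Φ N)) := by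
  intro σ T a₀ θ₀ u₀ Φ ℓ
  dsimp only
  intro τ hτ w hw N
  have hμ : localGibbsLaw σ a₀ u₀ θ₀ N (Φ N) (Φ N).goodᶜ = 0 := by
    have hac : localGibbsLaw σ a₀ u₀ θ₀ N (Φ N) ≪
        liouville (Torus.geometry (Fin 3)) (N + 1) (hsDiameter σ N) := by
      rw [localGibbsLaw, particleLaw_eq]
      exact withDensity_absolutelyContinuous _ _
    exact hac (Φ N).measure_compl_good
  -- the box kernel is jointly measurable, hence so is the kinetic deviation integrand; `S` is
  -- read off from `measurable_kinDevIntegrand` and matches the goal up to `β`/projection reduction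
  have key := aemeasurable_fluxPairing (Φ N) (fun i j => measurable_kinDevIntegrand
    (K := fun x y => {y' : T3 | ∀ i, ‖y' i - x i‖ < ℓ N / 2}.indicator (fun _ => (ℓ N ^ 3)⁻¹) y)
    (LGFS.measurable_boxK_uncurry (ℓ N)) i j) hτ hw hμ
  exact key

end FluxClosureB5

end Summit.AtomisticToContinuum.HydrodynamicLimit.Theorems

end
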